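import Mathlib
import Summits.NavierStokesRegularity.NavierStokesRegularity.Theorems.TaoLadderRungTwoBreakBlowupRigidityOnePeriodicClockedFront
import Summits.NavierStokesRegularity.NavierStokesRegularity.Theses.TaoLadderRungTwoBreak
import HarnessLib

/-!
# K2(1) `TaoLadderRungTwoBreak.BlowupRigidityOne` (stmt-NavierStokesRegularity-20206) BY NAME from the TYPE-I-FREE bundle
  «robust blow-up is a CLOCKED FRONT that is ASYMPTOTICALLY SHIFT-PERIODIC along its firing centres» — leaf link over
  `…PeriodicClockedFront`

MODEL lattice ODEs only (Tao 2016 §4, §6.4); nothing here is a statement about the Navier–Stokes equations; NO item is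
closed (`--supports stmt-NavierStokesRegularity-20206`). Thin by-name leaf (mathematics in the route-independent module
`…PeriodicClockedFront`, `survivingDSSWave_of_periodicClockedFront`).

* `blowupRigidityOne_of_periodicClockedFronts` — `H → BlowupRigidityOne`, `H` = below a threshold every robust blow-up
  (`NoGlobalCascade`) of an `E₂(R)` table admits an exact flow on some `[0,T)` with (i) per-shell ACTION CEILING, (ii)
  AMPLITUDE CEILING `B ν^j` at `(1+ε₀)⁻¹ ≤ ν² < 1`, (iii) CLOCKED FIRING (floor `c_f(ν²)^k`, two-sided clock), and (iv)
  ASYMPTOTIC `(q,T')`-PERIODICITY of its renormalisation along the firing centres (`q ≥ 1`, `T' > 0`). NO type-I bound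
  (N-39) and NO classification stub: compared with `blowupRigidityOne_of_periodicPinnedBlowups_of_lt_one` (p820070) the
  type-I clause is replaced by nothing (the g0 type-I-free extraction `clockedFront_limitData` feeds the periodic passage).

HONEST LABEL: `H` (the three-item front bundle (E2) + asymptotic periodicity (F3)) is OPEN and research-level; no stub,
crux or summit is proved; rung 0.
-/

noncomputable section

-- the summit and its single sub-problem share the name (CONVENTIONS §1)
set_option linter.dupNamespace false

open Set Filter Topology MeasureTheory

namespace Summit.NavierStokesRegularity.NavierStokesRegularity.Theorems

namespace BlowupRigidityOne

open Literature.Analysis.FluidPDE Literature.Analysis.FluidPDE.TaoCascade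
open Summit.NavierStokesRegularity.NavierStokesRegularity.Theses.TaoLadderRungTwoBreak

/-- **THE CRUX K2(1) `BlowupRigidityOne` BY NAME from the type-I-free periodic clocked-front bundle.**
[cite: Tao2016AveragedNS, §4 Thm. 4.2, §6.4; KochNadirashviliSereginSverak2009, Thm 1.1 ff.; cell vocabulary (`NoGlobalCascade`, `IsDSSWave`, `Surviving`)] -/
theorem blowupRigidityOne_of_periodicClockedFronts
    (H : ∀ R : ℝ, 1 ≤ R → ∃ εs : ℝ, 0 < εs ∧ ∀ ε₀ : ℝ, 0 < ε₀ → ε₀ ≤ εs →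
      ∀ (α : (Fin 4 → Fin 4 → Fin 4 → ℤ × ℤ × ℤ → ℝ)) (X₀ : Fin 4 → ℝ),
        InTableClass R α → NoGlobalCascade ε₀ α X₀ →
        ∃ (T A B ν cf κ₁ κ₂ T' : ℝ) (q : ℕ) (X : Fin 4 → ℤ → ℝ → ℝ) (W : ℤ → ℝ → Em 4) (τ : ℕ → ℝ),
          0 < T ∧
          (∀ i n, ContDiffOn ℝ 1 (X i n) (Set.Ico 0 T)) ∧
          (∀ i n t, 0 ≤ t → t < T → derivWithin (X i n) (Set.Ici 0) t = quadTerm ε₀ α X i n t) ∧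
          (∀ n σ, W n σ = (bigLam ε₀ ^ n * Real.exp (-σ)) • shellVec X n (T - Real.exp (-σ))) ∧
          (∀ k : ℤ, IntegrableOn (fun t => ‖shellVec X k t‖) (Ico 0 T) ∧
            bigLam ε₀ ^ k * (∫ t in Ico 0 T, ‖shellVec X k t‖) ≤ A) ∧
          0 < ν ∧ (1 + ε₀)⁻¹ ≤ ν ^ 2 ∧ ν < 1 ∧
          (∀ (j : ℤ) (t : ℝ), 0 ≤ t → t < T → ‖shellVec X j t‖ ≤ B * ν ^ j) ∧
          (∀ k : ℕ, 0 ≤ τ k ∧ τ k < T) ∧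
          (∀ k : ℕ, cf * (ν ^ 2) ^ k ≤ ‖shellVec X (k : ℤ) (τ k)‖ ^ 2) ∧
          (∀ k : ℕ, κ₁ ≤ (bigLam ε₀ ^ 2 * ν ^ 2) ^ k * (T - τ k) ^ 2) ∧
          (∀ k : ℕ, (bigLam ε₀ ^ 2 * ν ^ 2) ^ k * (T - τ k) ^ 2 ≤ κ₂) ∧
          0 < cf ∧ 0 < κ₁ ∧ 0 < κ₂ ∧ 0 < q ∧ 0 < T' ∧
          (∀ (n : ℤ) (σ : ℝ), Tendsto (fun j : ℕ =>
            W (n + q + (j : ℤ)) (σ + q * T' + -Real.log (T - τ j)) - W (n + (j : ℤ)) (σ + -Real.log (T - τ j)))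
              atTop (𝓝 0))) :
    BlowupRigidityOne := by
  intro R hR
  obtain ⟨εs, hεs, hH⟩ := H R hR
  refine ⟨εs, hεs, fun ε₀ hε hεle α X₀ hα hNG => ?_⟩
  obtain ⟨T, A, B, ν, cf, κ₁, κ₂, T', q, X, W, τ, hT, hC1, hmot, hW, hact, hν, hν1, hνlt, hamp, hτ, hfloor, hclock₁,
    hclock₂, hcf, hκ₁, hκ₂, hq, hT', hasym⟩ := hH ε₀ hε hεle α X₀ hα hNG
  exact survivingDSSWave_of_periodicClockedFront hε hT hC1 hmot hW hact hν hν1 hνlt hamp hτ hfloor hclock₁ hclock₂ hcf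
    hκ₁ hκ₂ hq hT' hasym

end BlowupRigidityOne

end Summit.NavierStokesRegularity.NavierStokesRegularity.Theorems

end
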